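import Mathlib
import Summits.ValiantsHypothesis.ValiantsHypothesis.Theses.ChowBorderDepth3
import Summits.ValiantsHypothesis.ValiantsHypothesis.Theorems.ChowBorderDepth3ChowToThesis
import Summits.ValiantsHypothesis.ValiantsHypothesis.Theorems.ChowBorderDepth3ChowBorderBoundStubTranslate
import Summits.ValiantsHypothesis.ValiantsHypothesis.Theorems.ChowBorderDepth3ChowBorderBoundStubInterpolate
import Summits.ValiantsHypothesis.ValiantsHypothesis.Theorems.ChowBorderDepth3ChowBorderBoundStubRescale
import Summits.ValiantsHypothesis.ValiantsHypothesis.Theorems.ChowBorderDepth3ChowBorderBoundStubGradedOfLocal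
import Summits.ValiantsHypothesis.ValiantsHypothesis.Theorems.ChowBorderDepth3ChowBorderBoundGradedOfCrux

/-!
# The vertex normal form of crux `ChowBorderDepth3.ChowBorderBound` (stmt-ValiantsHypothesis-5936):
# the crux is EQUIVALENT to its graded heart H

Line `registered` of the crux reduces `ChowBorderBound` (no border ΣΠΣ expression
`Σ_{i<r} Π_{j<D} ℓ_ij = ε^q per_n + ε^(q+1) G` of the padded permanent with
`r, D ≤ (n+2)^(c⌊√n⌋+c)`) to its heart, stub H (`stub_gradedESymBound`): no GRADED
ELEMENTARY-SYMMETRIC SYSTEM `ε^d Σ_i a_i e_d(m_i1,…,m_iD) = [d = n] ε^q per_n + ε^(q+1) G_d` in the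
chasm range.  With the four normal-form stubs now proved in the tree —

* `Translate.stub_translate` (generic translation: all constant terms non-zero),
* `Interpolate.stub_interpolate` (degree-`n` extraction over `D+1` scalings: `r ↦ r(D+1)`,
  homogeneous error term),
* `Rescale.stub_rescale` (`x ↦ ε^N x` and truncated units: the LOCAL shape `Π_j (1 + m_ij)`,
  `ε ∣ m_ij`),
* `GradedOfLocal.stub_gradedOfLocal` (grading into the elementary-symmetric system) —

this file records the sorry-free composition `H → ChowBorderBound` (H at `2c+1` gives the crux at
`c`) as the `mpr` direction of the equivalence

  `chowBorderBound_iff_graded : ChowBorderBound ↔ H`,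

whose `mp` direction is the converse transfer `GradedOfCrux.stub_gradedESymBound_of_crux`.  So the open content of the crux is exactly H:
`r` scalars and `r·D` linear forms in the `n²` matrix variables, tied degree by degree through
the elementary symmetric polynomials; its rung `r ≤ 2` is `FanInTwoRung.stub_gradedESymBound_fanInTwo`.

References: J. M. Landsberg, *Geometry and complexity theory*, CUP 2017, §7.5.3 (Cor. 7.5.3.3);
M. Kumar, ACM ToCT 12 (2020), doi:10.1145/3371506; Gupta–Kamath–Kayal–Saptharishi, SIAM J. Comput.
45 (2016) (the chasm at depth three).
-/

noncomputable section

-- `Summit.ValiantsHypothesis.ValiantsHypothesis.…` is the tree's mandated single-conjunct layout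
-- (Sub = Summit), so the duplicated namespace component is intended.
set_option linter.dupNamespace false

namespace Summit.ValiantsHypothesis.ValiantsHypothesis.Theorems.ChowBorderBound.OfGraded

open MvPolynomial Literature.Computability.AlgebraicComplexity
open scoped Polynomial

/-- Arithmetic of the chasm range: `r, D ≤ (n+2)^(c⌊√n⌋+c)` gives
`r·(D+1) ≤ (n+2)^((2c+1)⌊√n⌋+(2c+1))`. -/
theorem mul_succ_le_chasm {n c r D : ℕ} (hr : r ≤ (n + 2) ^ (c * Nat.sqrt n + c))
    (hD : D ≤ (n + 2) ^ (c * Nat.sqrt n + c)) :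
    r * (D + 1) ≤ (n + 2) ^ ((2 * c + 1) * Nat.sqrt n + (2 * c + 1)) := by
  have hD1 : D + 1 ≤ (n + 2) ^ ((c + 1) * Nat.sqrt n + (c + 1)) :=
    Summit.ValiantsHypothesis.ValiantsHypothesis.Theorems.chowToThesis_succ_le_pow hD
  calc r * (D + 1)
      ≤ (n + 2) ^ (c * Nat.sqrt n + c) * (n + 2) ^ ((c + 1) * Nat.sqrt n + (c + 1)) :=
        Nat.mul_le_mul hr hD1
    _ = (n + 2) ^ ((2 * c + 1) * Nat.sqrt n + (2 * c + 1)) := by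
        rw [← pow_add]; congr 1; ring

/-- Monotonicity of the chasm bound in `c`. -/
theorem chasm_mono {n c : ℕ} :
    (n + 2) ^ (c * Nat.sqrt n + c) ≤ (n + 2) ^ ((2 * c + 1) * Nat.sqrt n + (2 * c + 1)) :=
  Nat.pow_le_pow_right (by omega) (by nlinarith [Nat.zero_le (Nat.sqrt n), Nat.zero_le c])

/-- **The crux is equivalent to its graded heart H.**  `mp`: the converse transfer
`GradedOfCrux.stub_gradedESymBound_of_crux` (graded ⇒ local ⇒ border ΣΠΣ, same `c`).  `mpr`: the
vertex normal form — stub H at `2c+1` gives `ChowBorderDepth3.ChowBorderBound` at `c` (threshold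
`n₀(2c+1) + 1`) by the four proved normal-form stubs `Translate.stub_translate`,
`Interpolate.stub_interpolate` (`r ↦ r(D+1)`), `Rescale.stub_rescale`, `GradedOfLocal.stub_gradedOfLocal`
and the chasm arithmetic `mul_succ_le_chasm`. -/
theorem chowBorderBound_iff_graded :
    Summit.ValiantsHypothesis.ValiantsHypothesis.Theses.ChowBorderDepth3.ChowBorderBound ↔
    ∀ c : ℕ, ∃ n₀ : ℕ, ∀ n ≥ n₀, ∀ r D : ℕ, r ≤ (n + 2) ^ (c * Nat.sqrt n + c) →
      D ≤ (n + 2) ^ (c * Nat.sqrt n + c) →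
      ¬ ∃ (q : ℕ) (a : Fin r → Polynomial ℂ) (m : Fin r → Fin D → Fin n × Fin n → Polynomial ℂ)
          (G : ℕ → MvPolynomial (Fin n × Fin n) (Polynomial ℂ)),
          ∀ d : ℕ, MvPolynomial.C (Polynomial.X ^ d) *
              (∑ i, MvPolynomial.C (a i) *
                ∑ A ∈ Finset.powersetCard d (Finset.univ : Finset (Fin D)),
                  ∏ j ∈ A, ∑ v, MvPolynomial.C (m i j v) * MvPolynomial.X v) =
            (if d = n then
                MvPolynomial.C (Polynomial.X ^ q) *
                  MvPolynomial.map Polynomial.C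
                    (Literature.Computability.AlgebraicComplexity.perPoly (Fin n) ℂ)
              else 0) +
              MvPolynomial.C (Polynomial.X ^ (q + 1)) * G d := by
  refine ⟨GradedOfCrux.stub_gradedESymBound_of_crux, fun hH c => ?_⟩
  -- H at `2c+1` gives the crux at `c`: translate, interpolate (`r ↦ r(D+1)`), rescale, grade.
  obtain ⟨n₀, hn₀⟩ := hH (2 * c + 1)
  refine ⟨n₀ + 1, fun n hn r D hr hD hex => ?_⟩
  have hT := Translate.stub_translate n r D hex
  have hI := Interpolate.stub_interpolate n r D hT
  have hR := Rescale.stub_rescale n (r * (D + 1)) D hI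
  have hG := GradedOfLocal.stub_gradedOfLocal n (r * (D + 1)) D hR
  exact hn₀ n (by omega) (r * (D + 1)) D (mul_succ_le_chasm hr hD) (hD.trans chasm_mono) hG

end Summit.ValiantsHypothesis.ValiantsHypothesis.Theorems.ChowBorderBound.OfGraded

end
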